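import Mathlib
import Summits.Ventures.HodgeRepro.Tier4.Common.KTypeSpace
import Summits.Ventures.HodgeRepro.Tier4.Common.SettingOfData
import Summits.Ventures.HodgeRepro.Tier4.Line4.W4SpectralBridge

/-!
# Tier4/Line4/W3Reduction — the wall W3″ of LINE L4 from DISPLAYED spectral data (plan-4 (D), S13368): an admissible
constituent whose `K`-type space is spanned by a conjugate block of an adapted ONB, with Hecke eigen-relations, the
admissible-projector vanishing and `Jc(f₁ ⋆ f₂) ≠ 0`, gives the Riesz vector of the `T′`-period with a non-zero
`T`-period on that `K`-type space

Blind re-derivation cell `pub-hodge-repro`, Tier 4 (README §9–§10), seat t4-L1-p5 (prover, LINE L1, gen 2; the lead's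
cut S13371 (D), plan-4 g2 S13368 (D)).  Over a GENERIC plane `W` (the skeleton instantiates `W := seesawPlane …`,
`w₀ := w₀ d`): W3″'s conclusion — `∃ V admissible on the setting, ∃ K compact open in the finite part,
FiniteDimensional ℂ (V^{τ,K}) ∧ ∃ f, IsRieszVectorOn R μ DG (V^{τ,K}) f ∧ P_χ(f|_T) ≠ 0` — follows by name from
`W4SpectralBridge` (`exists_block_of_Jc_ne_zero`, `isRieszVectorOn_rieszOf`) once the spectral data are DISPLAYED:
a finite family `V i` of admissible constituents, a level `K`, an adapted orthonormal basis `φ` with pairwise disjoint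
blocks `F i` whose CONJUGATE blocks span the `K`-type spaces `kTypeSpace … K (V i)` (`hspan`), the eigen-relations
`ha`/`hb` (one scalar per block), the vanishing `hvan` outside the blocks, and W5 proper `R.Jc (f₁ ⋆ f₂) ≠ 0`.  The
period identification `R.periodT (restrictTo (torusT W) f) = periodLin W R.μT R.DT R.chi (restrictTo W (torusT W) f)`
is a DEFEQ (`RTFData.periodT` is `periodLin W R.μT R.DT R.chi` by definition).  WHAT IT BUYS: the wall becomes
«∃ the spectral data» with its residual explicit as a binder list — (a) Harish-Chandra admissibility + the spectral
decomposition of the adapted basis into `K`-type blocks, (b) the Hecke eigen-relations, (c) W5 for a block-killing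
pair — none of which is asserted here.  The continuity of `R.chi`, `R.chi'` and the unitarity of `R.chi` are three
further displayed binders (W3″ displays `‖R.chi' t‖ = 1` only).

Nothing here says anything about the status of the Hodge conjecture for CM abelian varieties, which is NOT proved
(HC_CM is NOT proved by anyone in this repository).
-/

set_option autoImplicit false

noncomputable section

namespace Summit.Ventures.HodgeRepro.Tier4.Line4

open Summit.Ventures.HodgeRepro.Tier4.Common Summit.Ventures.HodgeRepro.Tier4.Line1 MeasureTheory NumberField
open scoped ComplexConjugate

section Reduction

variable {k : Type} [Field k] [NumberField k] (W : PlaneData k) [MeasurableSpace (GA W)] [BorelSpace (GA W)]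
  (R : RTFData W) (μ : Measure (GA W)) [μ.IsHaarMeasure] [R.μT.IsHaarMeasure] [R.μT'.IsHaarMeasure]
  (DG : Set (GA W)) (fdG : IsFundamentalDomain (rationalPoints W) DG μ) (compG : IsCompact (closure DG))
  (compT : IsCompact (closure R.DT)) (compT' : IsCompact (closure R.DT'))

omit [BorelSpace (GA W)] [μ.IsHaarMeasure] [R.μT.IsHaarMeasure] [R.μT'.IsHaarMeasure] in
/-- the period identification is a definitional equality -/
theorem periodT_eq_periodLin (f : GA W → ℂ) :
    R.periodT (restrictTo W (torusT W) f) = periodLin W R.μT R.DT R.chi (restrictTo W (torusT W) f) := rfl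

omit [BorelSpace (GA W)] [μ.IsHaarMeasure] [R.μT.IsHaarMeasure] [R.μT'.IsHaarMeasure] in
/-- a Riesz vector whose `T`-period is non-zero has a non-zero `T′`-period on some basis vector of its block -/
theorem exists_period_ne_zero_of_rieszOf_period_ne_zero (F : Finset ℕ) (φ : ℕ → GA W → ℂ)
    (h : R.periodT (restrictTo W (torusT W)
      (RTF.Setting.rieszOf F (fun l x => conj (φ l x)) (periodT'Fun W R))) ≠ 0) :
    ∃ j ∈ F, periodT'Fun W R (fun x => conj (φ j x)) ≠ 0 := by
  by_contra hall
  apply h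
  have hz : RTF.Setting.rieszOf F (fun l x => conj (φ l x)) (periodT'Fun W R) = 0 := by
    funext x
    simp only [RTF.Setting.rieszOf, Pi.zero_apply]
    refine Finset.sum_eq_zero fun j hj => ?_
    have : periodT'Fun W R (fun x => conj (φ j x)) = 0 := by
      by_contra hne
      exact hall ⟨j, hj, hne⟩
    rw [this, map_zero, zero_mul]
  rw [hz]
  have h0 : restrictTo W (torusT W) (0 : GA W → ℂ) = 0 := rfl
  rw [h0, map_zero]

/-- **W3″ FROM DISPLAYED SPECTRAL DATA** (plan-4 (D)): a finite family of admissible constituents `V i` at the level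
`K`, an adapted orthonormal basis `φ` whose conjugate blocks `{conj ∘ φ j : j ∈ F i}` span the `K`-type spaces
`kTypeSpace … K (V i)`, the Hecke eigen-relations and the admissible-projector vanishing for `f₁, f₂`, and
`Jc(f₁ ⋆ f₂) ≠ 0` — then some `V i` carries, on its `K`-type space, a Riesz vector of the `T′`-period with a non-zero
`T`-period: the conclusion of the wall `mixed_two_torus_W3` (Skeleton v0.17 L456–L470) verbatim over a generic plane. -/
theorem mixed_two_torus_W3_of_spectral_data (hc : Continuous R.chi) (hu : ∀ a, ‖R.chi a‖ = 1)
    (hc' : Continuous R.chi') (hunit' : ∀ t, ‖R.chi' t‖ = 1)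
    (q : QuadData k) (g g' : Matrix (Fin 4) (Fin 4) k) (w₀ : InfinitePlace k)
    (eP eM eP' eM' : InfinitePlace k → ℤ) {m : ℕ} (V : Fin m → Submodule ℂ (GA W → ℂ))
    (hadm : ∀ i, IsAdmissibleS W (Setting.ofAdelicData W R μ DG fdG compG compT compT') q g g' w₀ eP eM eP' eM'
      (V i))
    (K : Subgroup (GA W)) (hK : IsCompactOpenIn W (finitePart W) K)
    {τ : ℕ → Set (GA W → ℂ)} {φ : ℕ → GA W → ℂ} {n : ℕ → ℕ}
    (hB : (Setting.ofAdelicData W R μ DG fdG compG compT compT').IsAdaptedONB τ φ n)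
    (F : Fin m → Finset ℕ) (hdisj : ∀ i i', i ≠ i' → Disjoint (F i) (F i'))
    (hspan : ∀ i, Submodule.span ℂ ((fun j => fun x => conj (φ j x)) '' (F i : Set ℕ)) =
      kTypeSpace W q g g' eP eM eP' eM' K (V i))
    {f₁ f₂ : GA W → ℂ} (h₁ : IsTestFn W f₁) (h₂ : IsTestFn W f₂) (a b : Fin m → ℂ)
    (ha : ∀ i, ∀ j ∈ F i, rightRegular W μ (RTF.cj f₁) (φ j) = fun x => a i * φ j x)
    (hb : ∀ i, ∀ j ∈ F i, rightRegular W μ (RTF.refl f₂) (φ j) = fun x => b i * φ j x)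
    (hvan : ∀ j, (∀ i, j ∉ F i) → rightRegular W μ (RTF.cj f₁) (φ j) = fun _ => 0)
    (hJ : R.Jc ((Setting.ofAdelicData W R μ DG fdG compG compT compT').conv f₁ f₂) ≠ 0) :
    ∃ V₀ : Submodule ℂ (GA W → ℂ),
      IsAdmissibleS W (Setting.ofAdelicData W R μ DG fdG compG compT compT') q g g' w₀ eP eM eP' eM' V₀ ∧
      ∃ K₀ : Subgroup (GA W), IsCompactOpenIn W (finitePart W) K₀ ∧
        FiniteDimensional ℂ (kTypeSpace W q g g' eP eM eP' eM' K₀ V₀) ∧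
        ∃ f : GA W → ℂ, IsRieszVectorOn R μ DG (kTypeSpace W q g g' eP eM eP' eM' K₀ V₀) f ∧
          periodLin W R.μT R.DT R.chi (restrictTo W (torusT W) f) ≠ 0 := by
  obtain ⟨i, -, hP⟩ := exists_block_of_Jc_ne_zero W R μ DG fdG compG compT compT' hc hu hc' hunit' hB h₁ h₂
    F hdisj a b ha hb hvan hJ
  have hne := exists_period_ne_zero_of_rieszOf_period_ne_zero W R (F i) φ hP
  refine ⟨V i, hadm i, K, hK, ?_, RTF.Setting.rieszOf (F i) (fun l x => conj (φ l x)) (periodT'Fun W R), ?_, ?_⟩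
  · rw [← hspan i]
    exact FiniteDimensional.span_of_finite ℂ ((F i).finite_toSet.image _)
  · exact isRieszVectorOn_rieszOf W R μ DG fdG compG compT compT' hB (F i) _ (hspan i).symm hne
  · exact hP

end Reduction

end Summit.Ventures.HodgeRepro.Tier4.Line4

end
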